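import Literature.NumberTheory.GaloisRepresentations.ContinuousCorestriction
import HarnessLib

/-!
# Transport of continuous `H¹` along an additive equivariant map of coefficients over DIFFERENT
# coefficient rings (the "(G-ℤ) glue" of row T-DER; cell `b2b-bsdres`, team n1011, row T-DER-GZ,
# file GZ-1; seat p13)

HONEST FRAMING (cell `b2b-bsdres`, run/shared/lean/b2b/bsd-rank1-residual/, verbatim in every
file): the goal of the cell is to DELETE the COMBINATION-SHAPED residual classes of the
Birch–Swinnerton-Dyer formula for ALL analytic-rank `≤ 1` elliptic curves over `ℚ` — "full BSD
formula for every rank `≤ 1` curve in class `C`" assembled STRICTLY from published theorems — so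
that the rank-`≤ 1` remainder becomes exactly the CONSTRUCTION-SHAPED classes, which are TYPED
(missing-input `Prop`s), NOT attempted. This is not "finishing BSD". Team n1011 (N10/N11, the
additive block `X4 ∧ p = 3`): research route on the CONSTRUCTION-SHAPED class X4 / §I N11; TOOL
theorems of continuous group cohomology only (ring-free, group-free, curve-free); nothing is booked;
no mark / label / flag text moves; census −0.  Theorems only: 0 defs, 0 named facts, 0 sorry.

## What and why

Row T-DER (n1011-p11) delivers Kolyvagin's derivative class `κ_r ∈ continuousCohomology 1 T'.toTopRep`
for a coefficient representation `T' : GaloisRep ℚ ℤ_[p] M'` — an object of `TopModuleCat ℤ_[p]`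
(`KolyvaginDerivativeDescent`, `KolyvaginDerivativeTate`) — while every consumer (the typed port
`KatoKuriharaDictionaryThreeAt`, `kolyvaginSystems`, `SelmerStructure`, …) speaks the `ℤ`-linear
currency `galoisCohomology ρ 1 = continuousCohomology 1 ρ.toTopRep` of a `DiscreteGaloisModule`
(`TopModuleCat ℤ`).  Mathlib's `ContinuousCohomology.map` cannot change the coefficient ring and
there is no restriction of scalars for `TopRep`.  This file supplies the comparison in degree one,
for ARBITRARY rings `R`, `S`: given `X : TopRep R G`, `Y : TopRep S G` and a continuous ADDITIVE
`G`-equivariant `e : X →+ Y` (typically the identity of one topological abelian group seen with two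
scalar rings): `comp_mem_contOneCocycles` (`g ↦ e (φ g)` is a continuous crossed homomorphism;
principal ↦ principal); **`exists_addMonoidHom_oneCocycleClass`** (an additive
`Φ : H¹(G, X) →+ H¹(G, Y)` with `Φ [φ] = [e ∘ φ]`, unique: `addMonoidHom_unique` — this
characterisation is the ONLY property used later, so every other statement is about ANY additive
`Φ` "computed on cocycles"); **`comm_map_of_oneCocycleClass`** (naturality under
`ContinuousCohomology.map` along compatible pairs intertwined by `e`, hence `comm_resLe`,
`comm_resSubgroup`, `comm_conjMap` and `comm_noncommProd_deriv_conjMap` — the operations and the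
derivative operator `D_r` in which THEOREM A3 of T-DER is stated); `injective_/surjective_of_…`,
**`exists_addEquiv_oneCocycleClass`** (`H¹(G, X) ≃+ H¹(G, Y)` when `e` is a homeomorphic additive
bijection).  Mathematically: continuous `H¹ = Z¹_cont/B¹` does not see the scalar ring (Serre,
*Galois Cohomology*, I.§2.2, I.§5.1; Rubin, *Euler Systems*, App. B.2); the tree's degree-one API
(`contOneCocycles`, `oneCocycleClass_surjective`, `oneCocycleClass_eq_zero_iff`,
`map_oneCocycleClass` of `ContinuousH1.lean`) makes it bookkeeping.

References: J.-P. Serre, *Galois Cohomology* (1997), I.§2.2, I.§2.4, I.§5.1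
[SerreGaloisCohomology1997]; K. Rubin, *Euler Systems* (2000), App. B.2 [Rubin2000].
-/

noncomputable section

open CategoryTheory

universe u u' v

namespace Summit.BirchSwinnertonDyer.Rank1Residual.GaloisImage.CoeffTransport

open Literature.NumberTheory.GaloisRepresentations

variable {R : Type u} [Ring R] [TopologicalSpace R] {S : Type u'} [Ring S] [TopologicalSpace S]
variable {G : Type v} [Group G] [TopologicalSpace G] [IsTopologicalGroup G]

/-! ## Cocycles along an additive equivariant continuous map of coefficients -/

section Cocycles

variable (X : TopRep.{v} R G) (Y : TopRep.{v} S G)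
  (e : X →+ Y) (hec : Continuous e) (he : ∀ (g : G) (x : X), e (X.ρ g x) = Y.ρ g (e x))

omit [IsTopologicalGroup G] in
include he in
/-- Pushing a continuous crossed homomorphism `φ : G → X` along a continuous additive
`G`-equivariant map `e : X → Y` gives a continuous crossed homomorphism `g ↦ e (φ g)` of `Y`
(whatever the two coefficient rings).  Serre, *Galois Cohomology*, I.§5.1. [folklore] -/
theorem comp_mem_contOneCocycles (φ : contOneCocycles X) :
    (⟨fun g => e (φ.1 g), hec.comp φ.1.continuous⟩ : C(G, Y)) ∈ contOneCocycles Y := by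
  intro g h
  change e (φ.1 (g * h)) = e (φ.1 g) + Y.ρ g (e (φ.1 h))
  rw [φ.2 g h, map_add, he]

omit [IsTopologicalGroup G] in
/-- Two continuous crossed homomorphisms of `Y` lying over the same `φ` are equal. [folklore] -/
theorem eq_of_forall_eq_comp {φ : contOneCocycles X} {ψ ψ' : contOneCocycles Y}
    (hψ : ∀ g, ψ.1 g = e (φ.1 g)) (hψ' : ∀ g, ψ'.1 g = e (φ.1 g)) : ψ = ψ' :=
  Subtype.ext (ContinuousMap.ext fun g => by rw [hψ g, hψ' g])

include he in
/-- A principal crossed homomorphism pushes forward to a principal one: `[φ] = 0 ⟹ [e ∘ φ] = 0`.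
Serre, *Galois Cohomology*, I.§5.1. [folklore] -/
theorem oneCocycleClass_eq_zero_of_comp {φ : contOneCocycles X} (hφ : oneCocycleClass X φ = 0)
    {ψ : contOneCocycles Y} (hψ : ∀ g, ψ.1 g = e (φ.1 g)) : oneCocycleClass Y ψ = 0 := by
  rw [oneCocycleClass_eq_zero_iff] at hφ ⊢
  obtain ⟨v, hv⟩ := hφ
  exact ⟨e v, fun g => by rw [hψ g, hv g, map_sub, he]⟩

include he in
/-- Cohomologous cocycles push forward to cohomologous cocycles. [folklore] -/
theorem oneCocycleClass_congr_of_comp {φ φ' : contOneCocycles X}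
    (h : oneCocycleClass X φ = oneCocycleClass X φ') {ψ ψ' : contOneCocycles Y}
    (hψ : ∀ g, ψ.1 g = e (φ.1 g)) (hψ' : ∀ g, ψ'.1 g = e (φ'.1 g)) :
    oneCocycleClass Y ψ = oneCocycleClass Y ψ' := by
  rw [← sub_eq_zero, ← oneCocycleClass_sub] at h ⊢
  refine oneCocycleClass_eq_zero_of_comp X Y e he h fun g => ?_
  change ψ.1 g - ψ'.1 g = e (φ.1 g - φ'.1 g)
  rw [map_sub, hψ g, hψ' g]

end Cocycles

/-! ## The transport on `H¹`: existence, uniqueness -/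

section Transport

variable (X : TopRep.{v} R G) (Y : TopRep.{v} S G)
  (e : X →+ Y) (hec : Continuous e) (he : ∀ (g : G) (x : X), e (X.ρ g x) = Y.ρ g (e x))

include hec he in
/-- **The transport of continuous `H¹` along an additive equivariant continuous map of
coefficients, across coefficient rings.**  There is an additive map
`Φ : H¹_cont(G, X) →+ H¹_cont(G, Y)` computed on continuous crossed homomorphisms by
`Φ [φ] = [e ∘ φ]`.  Serre, *Galois Cohomology*, I.§2.2, I.§5.1. [folklore] -/
theorem exists_addMonoidHom_oneCocycleClass :
    ∃ Φ : continuousCohomology 1 X →+ continuousCohomology 1 Y,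
      ∀ (φ : contOneCocycles X) (ψ : contOneCocycles Y), (∀ g, ψ.1 g = e (φ.1 g)) →
        Φ (oneCocycleClass X φ) = oneCocycleClass Y ψ := by
  classical
  -- a set-theoretic section of the class map and the push-forward of cocycles
  have hs : ∀ c : continuousCohomology 1 X,
      oneCocycleClass X (oneCocycleClass_surjective X c).choose = c :=
    fun c => (oneCocycleClass_surjective X c).choose_spec
  set s : continuousCohomology 1 X → contOneCocycles X :=
    fun c => (oneCocycleClass_surjective X c).choose with hs_def
  set push : contOneCocycles X → contOneCocycles Y :=
    fun φ => ⟨_, comp_mem_contOneCocycles X Y e hec he φ⟩ with hpush_def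
  have hpush : ∀ (φ : contOneCocycles X) (g : G), (push φ).1 g = e (φ.1 g) := fun _ _ => rfl
  have key : ∀ φ φ' : contOneCocycles X, oneCocycleClass X φ = oneCocycleClass X φ' →
      oneCocycleClass Y (push φ) = oneCocycleClass Y (push φ') :=
    fun φ φ' h => oneCocycleClass_congr_of_comp X Y e he h (hpush φ) (hpush φ')
  have push_add : ∀ φ φ' : contOneCocycles X, push (φ + φ') = push φ + push φ' := fun φ φ' =>
    Subtype.ext (ContinuousMap.ext fun g => by
      change e ((φ + φ').1 g) = e (φ.1 g) + e (φ'.1 g)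
      rw [← map_add]; rfl)
  have push_zero : push 0 = 0 :=
    Subtype.ext (ContinuousMap.ext fun g => by change e ((0 : contOneCocycles X).1 g) = 0; simp)
  refine ⟨{ toFun := fun c => oneCocycleClass Y (push (s c))
            map_zero' := ?_
            map_add' := fun a b => ?_ }, fun φ ψ hψ => ?_⟩
  · change oneCocycleClass Y (push (s 0)) = 0
    rw [key (s 0) 0 (by rw [hs, oneCocycleClass_zero]), push_zero, oneCocycleClass_zero]
  · change oneCocycleClass Y (push (s (a + b))) =
      oneCocycleClass Y (push (s a)) + oneCocycleClass Y (push (s b))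
    rw [key (s (a + b)) (s a + s b) (by rw [hs, oneCocycleClass_add, hs, hs]), push_add,
      oneCocycleClass_add]
  · change oneCocycleClass Y (push (s (oneCocycleClass X φ))) = oneCocycleClass Y ψ
    rw [key (s (oneCocycleClass X φ)) φ (hs _),
      eq_of_forall_eq_comp X Y e (hpush φ) hψ]

include hec he in
/-- **Uniqueness of the transport**: an additive map on `H¹_cont(G, X)` is determined by its
values on cocycle classes, so two maps computed by `[φ] ↦ [e ∘ φ]` coincide. [folklore] -/
theorem addMonoidHom_unique {Z : Type*} [AddZeroClass Z] (F : contOneCocycles Y → Z)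
    (Φ Φ' : continuousCohomology 1 X →+ Z)
    (hΦ : ∀ (φ : contOneCocycles X) (ψ : contOneCocycles Y), (∀ g, ψ.1 g = e (φ.1 g)) →
      Φ (oneCocycleClass X φ) = F ψ)
    (hΦ' : ∀ (φ : contOneCocycles X) (ψ : contOneCocycles Y), (∀ g, ψ.1 g = e (φ.1 g)) →
      Φ' (oneCocycleClass X φ) = F ψ) :
    Φ = Φ' := by
  refine AddMonoidHom.ext fun c => ?_
  obtain ⟨φ, rfl⟩ := oneCocycleClass_surjective X c
  rw [hΦ φ ⟨_, comp_mem_contOneCocycles X Y e hec he φ⟩ fun _ => rfl,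
    hΦ' φ ⟨_, comp_mem_contOneCocycles X Y e hec he φ⟩ fun _ => rfl]

end Transport

/-! ## Naturality: the transport commutes with `ContinuousCohomology.map`, `resLe`,
`resSubgroup`, `conjMap` -/

section Naturality

variable {H : Type v} [Group H] [TopologicalSpace H] [IsTopologicalGroup H]
variable (X : TopRep.{v} R G) (Y : TopRep.{v} S G) (e : X →+ Y)
variable {X' : TopRep.{v} R H} {Y' : TopRep.{v} S H} (e' : X' →+ Y')

/-- **Naturality of the coefficient transport under compatible pairs** `(θ : H → G, f : θ^* X ⟶ X')`
over `R` and `(θ, f' : θ^* Y ⟶ Y')` over `S`, intertwined by additive `e : X →+ Y`, `e' : X' →+ Y'`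
(`e' ∘ f = f' ∘ e`): transports `Φ`, `Φ'` computed on cocycles by `e`, `e'` satisfy
`Φ' ∘ (θ, f)^* = (θ, f')^* ∘ Φ` on `H¹` (Mathlib `ContinuousCohomology.map`; tree
`map_oneCocycleClass`).  Serre, *Galois Cohomology*, I.§2.4. [folklore] -/
theorem comm_map_of_oneCocycleClass (θ : H →ₜ* G) (f : TopRep.res (θ : H →* G) X ⟶ X')
    (f' : TopRep.res (θ : H →* G) Y ⟶ Y') (hee' : ∀ x : X, e' (f.hom x) = f'.hom (e x))
    (Φ : continuousCohomology 1 X →+ continuousCohomology 1 Y)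
    (hΦ : ∀ (φ : contOneCocycles X) (ψ : contOneCocycles Y), (∀ g, ψ.1 g = e (φ.1 g)) →
      Φ (oneCocycleClass X φ) = oneCocycleClass Y ψ)
    (Φ' : continuousCohomology 1 X' →+ continuousCohomology 1 Y')
    (hΦ' : ∀ (φ : contOneCocycles X') (ψ : contOneCocycles Y'), (∀ g, ψ.1 g = e' (φ.1 g)) →
      Φ' (oneCocycleClass X' φ) = oneCocycleClass Y' ψ)
    (hec : Continuous e) (he : ∀ (g : G) (x : X), e (X.ρ g x) = Y.ρ g (e x))
    (c : continuousCohomology 1 X) :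
    Φ' (ContinuousCohomology.map θ f 1 c) = ContinuousCohomology.map θ f' 1 (Φ c) := by
  obtain ⟨φ, rfl⟩ := oneCocycleClass_surjective X c
  set ψ : contOneCocycles Y := ⟨_, comp_mem_contOneCocycles X Y e hec he φ⟩ with hψ_def
  have hψ : ∀ g, ψ.1 g = e (φ.1 g) := fun _ => rfl
  rw [hΦ φ ψ hψ, map_oneCocycleClass, map_oneCocycleClass,
    hΦ' (contOneCocycles.pullback θ f φ) (contOneCocycles.pullback θ f' ψ) fun g => ?_]
  rw [contOneCocycles.pullback_apply, contOneCocycles.pullback_apply, hψ, hee']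

/-- **The transport commutes with restriction** `resLe` to a smaller subgroup (`H₁ ≤ H₂ ≤ G`):
`Φ_{H₁} ∘ res = res ∘ Φ_{H₂}`.  Serre, *Galois Cohomology*, I.§2.4. [folklore] -/
theorem comm_resLe {H₁ H₂ : Subgroup G} (h : H₁ ≤ H₂)
    (Φ₂ : continuousCohomology 1 (subgroupRep X H₂) →+ continuousCohomology 1 (subgroupRep Y H₂))
    (hΦ₂ : ∀ (φ : contOneCocycles (subgroupRep X H₂)) (ψ : contOneCocycles (subgroupRep Y H₂)),
      (∀ g, ψ.1 g = e (φ.1 g)) → Φ₂ (oneCocycleClass _ φ) = oneCocycleClass _ ψ)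
    (Φ₁ : continuousCohomology 1 (subgroupRep X H₁) →+ continuousCohomology 1 (subgroupRep Y H₁))
    (hΦ₁ : ∀ (φ : contOneCocycles (subgroupRep X H₁)) (ψ : contOneCocycles (subgroupRep Y H₁)),
      (∀ g, ψ.1 g = e (φ.1 g)) → Φ₁ (oneCocycleClass _ φ) = oneCocycleClass _ ψ)
    (hec : Continuous e) (he : ∀ (g : G) (x : X), e (X.ρ g x) = Y.ρ g (e x))
    (c : continuousCohomology 1 (subgroupRep X H₂)) :
    Φ₁ (resLe X h 1 c) = resLe Y h 1 (Φ₂ c) := by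
  obtain ⟨φ, rfl⟩ := oneCocycleClass_surjective (subgroupRep X H₂) c
  rw [hΦ₂ φ ⟨_, comp_mem_contOneCocycles (subgroupRep X H₂) (subgroupRep Y H₂) e hec
      (fun g x => he g x) φ⟩ (fun _ => rfl), resLe_oneCocycleClass, resLe_oneCocycleClass]
  exact hΦ₁ _ _ fun _ => rfl

/-- **The transport commutes with restriction** `resSubgroup` from `G` to a subgroup `H ≤ G`:
`Φ_H ∘ res = res ∘ Φ_G`.  Serre, *Galois Cohomology*, I.§2.4. [folklore] -/
theorem comm_resSubgroup (H₁ : Subgroup G)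
    (Φ : continuousCohomology 1 X →+ continuousCohomology 1 Y)
    (hΦ : ∀ (φ : contOneCocycles X) (ψ : contOneCocycles Y), (∀ g, ψ.1 g = e (φ.1 g)) →
      Φ (oneCocycleClass X φ) = oneCocycleClass Y ψ)
    (Φ₁ : continuousCohomology 1 (subgroupRep X H₁) →+ continuousCohomology 1 (subgroupRep Y H₁))
    (hΦ₁ : ∀ (φ : contOneCocycles (subgroupRep X H₁)) (ψ : contOneCocycles (subgroupRep Y H₁)),
      (∀ g, ψ.1 g = e (φ.1 g)) → Φ₁ (oneCocycleClass _ φ) = oneCocycleClass _ ψ)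
    (hec : Continuous e) (he : ∀ (g : G) (x : X), e (X.ρ g x) = Y.ρ g (e x))
    (c : continuousCohomology 1 X) :
    Φ₁ (resSubgroup X H₁ 1 c) = resSubgroup Y H₁ 1 (Φ c) := by
  obtain ⟨φ, rfl⟩ := oneCocycleClass_surjective X c
  rw [hΦ φ ⟨_, comp_mem_contOneCocycles X Y e hec he φ⟩ (fun _ => rfl),
    resSubgroup_oneCocycleClass, resSubgroup_oneCocycleClass]
  exact hΦ₁ _ _ fun _ => rfl

/-- **The transport commutes with the conjugation action** `conjMap` of `g ∈ G` on `H¹(H, –)`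
for a normal subgroup `H` (on cocycles `(g·φ)(x) = g • φ(g⁻¹ x g)`): `Φ_H ∘ g_* = g_* ∘ Φ_H`.
Serre, *Local Fields*, VII.§5. [folklore] -/
theorem comm_conjMap (H₁ : Subgroup G) [H₁.Normal] (g : G)
    (Φ₁ : continuousCohomology 1 (subgroupRep X H₁) →+ continuousCohomology 1 (subgroupRep Y H₁))
    (hΦ₁ : ∀ (φ : contOneCocycles (subgroupRep X H₁)) (ψ : contOneCocycles (subgroupRep Y H₁)),
      (∀ g, ψ.1 g = e (φ.1 g)) → Φ₁ (oneCocycleClass _ φ) = oneCocycleClass _ ψ)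
    (hec : Continuous e) (he : ∀ (g : G) (x : X), e (X.ρ g x) = Y.ρ g (e x))
    (c : continuousCohomology 1 (subgroupRep X H₁)) :
    Φ₁ (conjMap X H₁ g 1 c) = conjMap Y H₁ g 1 (Φ₁ c) := by
  obtain ⟨φ, rfl⟩ := oneCocycleClass_surjective (subgroupRep X H₁) c
  rw [hΦ₁ φ ⟨_, comp_mem_contOneCocycles (subgroupRep X H₁) (subgroupRep Y H₁) e hec
      (fun g x => he g x) φ⟩ (fun _ => rfl), conjMap_oneCocycleClass, conjMap_oneCocycleClass]
  refine hΦ₁ _ _ fun x => ?_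
  rw [conj_pullback_apply, conj_pullback_apply]
  exact (he g _).symm

end Naturality

/-! ## Bijectivity for a homeomorphic additive equivariant bijection of coefficients -/

section Bijective

variable (X : TopRep.{v} R G) (Y : TopRep.{v} S G)
  (e : X →+ Y) (hec : Continuous e) (he : ∀ (g : G) (x : X), e (X.ρ g x) = Y.ρ g (e x))
  (einv : Y →+ X) (hic : Continuous einv) (h₁ : ∀ x, einv (e x) = x) (h₂ : ∀ y, e (einv y) = y)

include he h₁ h₂ in
omit [TopologicalSpace G] [IsTopologicalGroup G] in
/-- The inverse of an equivariant additive bijection is equivariant. [folklore] -/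
theorem inv_equivariant (g : G) (y : Y) : einv (Y.ρ g y) = X.ρ g (einv y) := by
  have h := he g (einv y)
  rw [h₂] at h
  rw [← h, h₁]

include he h₁ h₂ in
/-- **Injectivity**: if `e` is an additive bijection, a transport computed by `[φ] ↦ [e ∘ φ]` is
injective (`[e ∘ φ] = 0` gives `e (φ g) = g • w - w` with `w = e v`, whence `φ g = g • v - v`).
[folklore] -/
theorem injective_of_oneCocycleClass (Φ : continuousCohomology 1 X →+ continuousCohomology 1 Y)
    (hΦ : ∀ (φ : contOneCocycles X) (ψ : contOneCocycles Y), (∀ g, ψ.1 g = e (φ.1 g)) →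
      Φ (oneCocycleClass X φ) = oneCocycleClass Y ψ)
    (hec : Continuous e) : Function.Injective Φ := by
  refine (injective_iff_map_eq_zero Φ).mpr fun c hc => ?_
  obtain ⟨φ, rfl⟩ := oneCocycleClass_surjective X c
  rw [hΦ φ ⟨_, comp_mem_contOneCocycles X Y e hec he φ⟩ (fun _ => rfl),
    oneCocycleClass_eq_zero_iff] at hc
  obtain ⟨w, hw⟩ := hc
  rw [oneCocycleClass_eq_zero_iff]
  refine ⟨einv w, fun g => ?_⟩
  have h := congrArg einv (hw g)
  change einv (e (φ.1 g)) = _ at h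
  rw [h₁, map_sub, inv_equivariant X Y e he einv h₁ h₂] at h
  exact h

include he h₁ h₂ hic in
/-- **Surjectivity**: if `e` is an additive bijection with continuous inverse, a transport
computed by `[φ] ↦ [e ∘ φ]` is surjective (`[ψ]` is hit by `[e⁻¹ ∘ ψ]`). [folklore] -/
theorem surjective_of_oneCocycleClass (Φ : continuousCohomology 1 X →+ continuousCohomology 1 Y)
    (hΦ : ∀ (φ : contOneCocycles X) (ψ : contOneCocycles Y), (∀ g, ψ.1 g = e (φ.1 g)) →
      Φ (oneCocycleClass X φ) = oneCocycleClass Y ψ) :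
    Function.Surjective Φ := by
  intro c
  obtain ⟨ψ, rfl⟩ := oneCocycleClass_surjective Y c
  refine ⟨oneCocycleClass X ⟨_, comp_mem_contOneCocycles Y X einv hic
    (fun g y => inv_equivariant X Y e he einv h₁ h₂ g y) ψ⟩, hΦ _ ψ fun g => ?_⟩
  change ψ.1 g = e (einv (ψ.1 g))
  rw [h₂]

include hec he hic h₁ h₂ in
/-- **Continuous `H¹` does not see the coefficient ring.**  For a homeomorphic additive
`G`-equivariant bijection `e : X → Y` between topological representations over two rings `R`, `S`
there is an additive isomorphism `H¹_cont(G, X) ≃+ H¹_cont(G, Y)` computed on cocycles by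
`[φ] ↦ [e ∘ φ]` (the case of interest: `e = id` on a finite discrete `Γ_K`-module carrying a
`ℤ_p`-structure and its underlying `ℤ`-structure).  Serre, *Galois Cohomology*, I.§2.2, I.§5.1;
Rubin, *Euler Systems*, App. B.2. [folklore] -/
theorem exists_addEquiv_oneCocycleClass :
    ∃ Φ : continuousCohomology 1 X ≃+ continuousCohomology 1 Y,
      ∀ (φ : contOneCocycles X) (ψ : contOneCocycles Y), (∀ g, ψ.1 g = e (φ.1 g)) →
        Φ (oneCocycleClass X φ) = oneCocycleClass Y ψ := by
  obtain ⟨Φ, hΦ⟩ := exists_addMonoidHom_oneCocycleClass X Y e hec he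
  exact ⟨AddEquiv.ofBijective Φ ⟨injective_of_oneCocycleClass X Y e he einv h₁ h₂ Φ hΦ hec,
    surjective_of_oneCocycleClass X Y e he einv hic h₁ h₂ Φ hΦ⟩, hΦ⟩

end Bijective

/-! ## Transport of Kolyvagin's derivative operators (the shape of THEOREM A3 of row T-DER) -/

section Operators

variable {M : Type*} [AddCommGroup M] [Module R M] {M' : Type*} [AddCommGroup M'] [Module S M']

omit [TopologicalSpace R] [TopologicalSpace S] in
/-- An additive map intertwining `F` and `F'` intertwines their powers. [folklore] -/
theorem addMonoidHom_apply_pow_apply (f : M →+ M') {F : Module.End R M} {F' : Module.End S M'}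
    (h : ∀ v, f (F v) = F' (f v)) (i : ℕ) (v : M) : f ((F ^ i) v) = (F' ^ i) (f v) := by
  induction i generalizing v with
  | zero => rfl
  | succ i ih => rw [pow_succ, pow_succ, Module.End.mul_apply, Module.End.mul_apply, ih, h]

omit [TopologicalSpace R] [TopologicalSpace S] in
/-- An additive map intertwining `F` and `F'` carries the derivative operator `Σ_{i<N} i F^i`
(over `R`) to `Σ_{i<N} i F'^i` (over `S`). [folklore] -/
theorem addMonoidHom_apply_deriv_apply (f : M →+ M') {F : Module.End R M} {F' : Module.End S M'}
    (h : ∀ v, f (F v) = F' (f v)) (N : ℕ) (v : M) :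
    f ((∑ i ∈ Finset.range N, (i : Module.End R M) * F ^ i) v) =
      (∑ i ∈ Finset.range N, (i : Module.End S M') * F' ^ i) (f v) := by
  rw [LinearMap.sum_apply, LinearMap.sum_apply, map_sum]
  refine Finset.sum_congr rfl fun i _ => ?_
  rw [Module.End.mul_apply, Module.End.mul_apply, Module.End.natCast_apply,
    Module.End.natCast_apply, map_nsmul, addMonoidHom_apply_pow_apply f h i v]

omit [TopologicalSpace R] [TopologicalSpace S] in
/-- An additive map intertwining two commuting families of operators termwise intertwines their
products (`Finset.noncommProd`). [folklore] -/
theorem addMonoidHom_apply_noncommProd_apply {ι : Type*} (f : M →+ M')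
    (D : ι → Module.End R M) (D' : ι → Module.End S M') (s : Finset ι)
    (comm : (s : Set ι).Pairwise fun a b => Commute (D a) (D b))
    (comm' : (s : Set ι).Pairwise fun a b => Commute (D' a) (D' b))
    (h : ∀ ℓ ∈ s, ∀ v, f (D ℓ v) = D' ℓ (f v)) (v : M) :
    f (s.noncommProd D comm v) = s.noncommProd D' comm' (f v) := by
  classical
  induction s using Finset.induction_on generalizing v with
  | empty => simp
  | insert a s ha ih =>
    rw [Finset.noncommProd_insert_of_notMem _ _ _ _ ha,
      Finset.noncommProd_insert_of_notMem _ _ _ _ ha, Module.End.mul_apply, Module.End.mul_apply,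
      h a (Finset.mem_insert_self a s),
      ih (comm.mono (Finset.coe_subset.2 (Finset.subset_insert a s)))
        (comm'.mono (Finset.coe_subset.2 (Finset.subset_insert a s)))
        (fun ℓ hℓ => h ℓ (Finset.mem_insert_of_mem hℓ))]

variable (X : TopRep.{v} R G) (Y : TopRep.{v} S G) (e : X →+ Y)

/-- **The coefficient transport intertwines Kolyvagin's derivative operators.**  For a normal
subgroup `U ≤ G`, elements `σ_ℓ ∈ G` and lengths `N_ℓ`, a transport `Φ_U : H¹(U, X) →+ H¹(U, Y)`
computed on cocycles by `e` carries `D_r = ∏_{ℓ ∈ r} Σ_{j<N_ℓ} j σ_ℓ^j` (acting through `conjMap`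
over `R`) to the same operator over `S`: `Φ_U (D_r x) = D_r (Φ_U x)` — the shape in which THEOREM A3
of row T-DER (`Derivative.existsUnique_res_eq_deriv`) states the derivative class.
Rubin, *Euler Systems* (2000), Def. 4.4.1. [folklore] -/
theorem comm_noncommProd_deriv_conjMap {ι : Type*} (U : Subgroup G) [U.Normal]
    (σ : ι → G) (N : ι → ℕ) (r : Finset ι)
    (Φ : continuousCohomology 1 (subgroupRep X U) →+ continuousCohomology 1 (subgroupRep Y U))
    (hΦ : ∀ (φ : contOneCocycles (subgroupRep X U)) (ψ : contOneCocycles (subgroupRep Y U)),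
      (∀ g, ψ.1 g = e (φ.1 g)) → Φ (oneCocycleClass _ φ) = oneCocycleClass _ ψ)
    (hec : Continuous e) (he : ∀ (g : G) (x : X), e (X.ρ g x) = Y.ρ g (e x)) (comm) (comm')
    (x : continuousCohomology 1 (subgroupRep X U)) :
    Φ ((r.noncommProd (fun ℓ => ∑ j ∈ Finset.range (N ℓ),
        (j : Module.End R (continuousCohomology 1 (subgroupRep X U))) *
          (conjMap X U (σ ℓ) 1).hom.toLinearMap ^ j) comm) x) =
      (r.noncommProd (fun ℓ => ∑ j ∈ Finset.range (N ℓ),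
        (j : Module.End S (continuousCohomology 1 (subgroupRep Y U))) *
          (conjMap Y U (σ ℓ) 1).hom.toLinearMap ^ j) comm') (Φ x) :=
  addMonoidHom_apply_noncommProd_apply Φ _ _ r comm comm'
    (fun ℓ _ v => addMonoidHom_apply_deriv_apply Φ
      (fun w => comm_conjMap X Y e U (σ ℓ) Φ hΦ hec he w) (N ℓ) v) x

end Operators

end Summit.BirchSwinnertonDyer.Rank1Residual.GaloisImage.CoeffTransport

end
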